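import Literature.NumberTheory.EllipticCurves.ModularSymbolsGreenbergLifting
import Literature.NumberTheory.EllipticCurves.ModularSymbolsCompletion
import HarnessLib

/-!
# The existence half of Stevens' control theorem in slope `0` (coefficients `D̂_k`)

Assembly of Greenberg's lifting (`ModularSymbolsGreenbergLifting`) in the `F`-completion
`D̂_k = lim_N 𝔻⁰_k / F^N` (`ModularSymbolsCompletion` with `W N = filGInt p k N`, invariant by
`isInvariant_filGInt`): for `p ∣ N`, a unit `u ∈ ℤ_p^×` and an additive `𝔻⁰_k`-valued `Φ₀` whose
`Γ₀(N)`-invariance and `U_p`-eigen defects are invisible to the moments of order `≤ k` (for instance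
ANY additive lift of an exact `Symᵏ`-valued `U_p`-eigensymbol of eigenvalue `u`,
`ModularSymbolsGreenbergLifting.exists_additive_lift`), **there is a `Γ₀(N)`-invariant modular symbol
`Φ̂` with values in `D̂_k`, `U_p Φ̂ = u Φ̂`, lifting `Φ₀` modulo `F⁰`** (`exists_hatEigensymbol`) — Greenberg
2007, Thm. 9 (surjectivity of `π₀^*` in slope `0`), Stevens' control theorem (Eigenbook Thm. 6.5.19) in
the ordinary case, for the coefficient module `D̂_k ⊆ D_k(O)`.

Construction: the reductions `Φ_n mod F^n` of Greenberg's sequence are genuine, compatible,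
`U_p`-eigen symbols in `Symb(𝔻⁰/F^n)` (`redSymb`, `redSymb_compat`, `hecke_redSymb`); glue them
(`CoeffActionOn.glueHat`).

Brick B3e-S3b of the bottom-up plan recorded with the named fact
`greenbergStevens_kitagawa_twoVariable_interpolation_allBranches`.  Everything is proved; no named facts.

## References

* M. Greenberg, Israel J. Math. 161 (2007), Thm. 9, Prop. 12. [Greenberg2007Lifting]
* J. Bellaïche, *The Eigenbook* (2021), Thm. 6.5.19. [folklore]
-/

noncomputable section

open scoped MatrixGroups
open Matrix CongruenceSubgroup

namespace Literature.NumberTheory.EllipticCurves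

open ModularForms ModularForms.HidaCohomology

variable {p : ℕ} [Fact p.Prime]

/-! ### The coefficient system `D̂_k` -/

section Hat

/-- Greenberg's filtration is decreasing (as submodules of `𝔻⁰`). [folklore] -/
theorem filGInt_antitone (k : ℕ) : Antitone fun n => filGInt p k n :=
  fun _ _ h _ hμ => (mem_filGInt_iff (p := p)).mpr (filG_antitone k h hμ)

variable (p) in
/-- The module `D̂_k = lim_N 𝔻⁰_k / F^N` (compatible families). [cite: Greenberg2007Lifting, §3] -/
abbrev HatD (k : ℕ) : Type :=
  ↥(CoeffActionOn.hatSub (R := ℤ_[p]) (V := DInt p) (W := fun n => filGInt p k n) (filGInt_antitone k))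

/-- The additive group structure of `D̂_k` (instance search needs the module spelled out). [folklore] -/
instance instAddCommGroupHatD (k : ℕ) : AddCommGroup (HatD p k) :=
  @Submodule.addCommGroup ℤ_[p] ((N : ℕ) → DInt p ⧸ filGInt p k N) _ _ _ _

/-- The `ℤ_p`-module structure of `D̂_k`. [folklore] -/
instance instModuleHatD (k : ℕ) : Module ℤ_[p] (HatD p k) :=
  @Submodule.module ℤ_[p] ((N : ℕ) → DInt p ⧸ filGInt p k N) _ _ _ _

variable (p) in
/-- **The `F`-completion `D̂_k = lim_N 𝔻⁰_k / F^N`** as a coefficient system on `Σ₀(N)` (`p ∣ N`).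
[cite: Greenberg2007Lifting, §3] -/
def hatDist (k N : ℕ) (hpN : p ∣ N) : CoeffActionOn (sigma0Set N) ℤ_[p] (HatD p k) :=
  (distCoeffInt p k N hpN).hat (sigma0Set_mulClosed N) (isInvariant_filGInt k N hpN) (filGInt_antitone k)

/-- The level-`n` approximation system `𝔻⁰_k / F^n`. [cite: Greenberg2007Lifting, §3] -/
def filQuot (k N : ℕ) (hpN : p ∣ N) (n : ℕ) : CoeffActionOn (sigma0Set N) ℤ_[p] (DInt p ⧸ filGInt p k n) :=
  (distCoeffInt p k N hpN).quotient (sigma0Set_mulClosed N) (isInvariant_filGInt k N hpN n)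

/-- The reduction morphism `𝔻⁰_k → 𝔻⁰_k / F^n`. [folklore] -/
def filRedHom (k N : ℕ) (hpN : p ∣ N) (n : ℕ) : CoeffActionOn.Hom (distCoeffInt p k N hpN) (filQuot k N hpN n) :=
  (distCoeffInt p k N hpN).mkQHom (sigma0Set_mulClosed N) (isInvariant_filGInt k N hpN n)

end Hat

/-! ### The reductions of Greenberg's sequence are compatible eigensymbols -/

section Red

variable [NeZero p] (k : ℕ) {N : ℕ} (hpN : p ∣ N) (u : ℤ_[p]ˣ) (Φ₀ : P1Q → P1Q → DInt p)
  (h0 : Φ₀ ∈ modSym ℤ_[p] (DInt p))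
  (hΓ0 : ∀ γ : Gamma0 N, ∀ x y, ((distCoeffInt p k N hpN).slash (gmat γ) Φ₀ - Φ₀) x y ∈ filGInt p k 0)
  (hU0 : ∀ x y, ((distCoeffInt p k N hpN).hecke N p Φ₀ - (u : ℤ_[p]) • Φ₀) x y ∈ filGInt p k 0)

omit [NeZero p] in
/-- A function congruent to zero modulo `F^n` reduces to zero. [folklore] -/
theorem filRed_eq_of_sub_mem {n : ℕ} {Ψ Ψ' : P1Q → P1Q → DInt p} (h : ∀ x y, (Ψ - Ψ') x y ∈ filGInt p k n) :
    (filRedHom k N hpN n).mapFun Ψ = (filRedHom k N hpN n).mapFun Ψ' := by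
  funext x y
  rw [CoeffActionOn.Hom.mapFun_apply, CoeffActionOn.Hom.mapFun_apply]
  exact (Submodule.Quotient.eq _).mpr (h x y)

include h0 hΓ0 hU0 in
/-- **`Φ_n mod F^n` is a `Γ₀(N)`-invariant symbol.** [cite: Greenberg2007Lifting, Prop. 12] -/
theorem filRed_liftSeq_mem_Symb (n : ℕ) :
    (filRedHom k N hpN n).mapFun (liftSeq k hpN u Φ₀ n) ∈ (filQuot k N hpN n).Symb (Gamma0 N) := by
  obtain ⟨hadd, hΓ, -, -⟩ := liftSeq_spec k hpN u Φ₀ h0 hΓ0 hU0 n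
  refine ⟨(filRedHom k N hpN n).mapFun_mem_modSym hadd, fun γ hγ => ?_⟩
  rw [← (filRedHom k N hpN n).mapFun_slash (coe_mem_sigma0Set' γ hγ)]
  exact filRed_eq_of_sub_mem k hpN (hΓ ⟨γ, hγ⟩)

/-- **The reduced symbols** `Φ_n mod F^n ∈ Symb(𝔻⁰/F^n)`. [cite: Greenberg2007Lifting, Prop. 12] -/
def redSymb (n : ℕ) : (filQuot k N hpN n).Symb (Gamma0 N) :=
  ⟨(filRedHom k N hpN n).mapFun (liftSeq k hpN u Φ₀ n), filRed_liftSeq_mem_Symb k hpN u Φ₀ h0 hΓ0 hU0 n⟩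

/-- Values of the reduced symbols. [folklore] -/
theorem redSymb_val (n : ℕ) (x y : P1Q) :
    (redSymb k hpN u Φ₀ h0 hΓ0 hU0 n).1 x y = Submodule.Quotient.mk (liftSeq k hpN u Φ₀ n x y) := rfl

/-- **Compatibility** of the reduced symbols along `𝔻⁰/F^{n'} → 𝔻⁰/F^n`. [folklore] -/
theorem redSymb_compat {n n' : ℕ} (h : n ≤ n') (x y : P1Q) :
    CoeffActionOn.transQ (filGInt_antitone (p := p) k) h ((redSymb k hpN u Φ₀ h0 hΓ0 hU0 n').1 x y) =
      (redSymb k hpN u Φ₀ h0 hΓ0 hU0 n).1 x y := by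
  rw [redSymb_val, redSymb_val, CoeffActionOn.transQ_mk]
  exact (Submodule.Quotient.eq _).mpr (liftSeq_congr k hpN u Φ₀ h0 hΓ0 hU0 h x y)

/-- **The reduced symbols are exact `U_p`-eigensymbols**: `U_p (Φ_n mod F^n) = u (Φ_n mod F^n)`.
[cite: Greenberg2007Lifting, Prop. 12] -/
theorem hecke_redSymb (n : ℕ) :
    (filQuot k N hpN n).hecke N p (redSymb k hpN u Φ₀ h0 hΓ0 hU0 n).1 = (u : ℤ_[p]) • (redSymb k hpN u Φ₀ h0 hΓ0 hU0 n).1 := by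
  obtain ⟨-, -, hU, -⟩ := liftSeq_spec k hpN u Φ₀ h0 hΓ0 hU0 n
  change (filQuot k N hpN n).hecke N p ((filRedHom k N hpN n).mapFun (liftSeq k hpN u Φ₀ n)) =
    (u : ℤ_[p]) • (filRedHom k N hpN n).mapFun (liftSeq k hpN u Φ₀ n)
  rw [← (filRedHom k N hpN n).mapFun_hecke (fun i => heckeRep_mem_sigma0Set Fact.out i), ← map_smul]
  exact filRed_eq_of_sub_mem k hpN hU

end Red

/-! ### The theorem -/

section Main

variable [NeZero p] (k : ℕ) {N : ℕ} (hpN : p ∣ N) (u : ℤ_[p]ˣ)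

/-- **Existence half of the slope-`0` control theorem (Greenberg 2007, Thm. 9; Stevens).**  Let
`Φ₀` be an additive `𝔻⁰_k`-valued function of pairs of cusps whose `Γ₀(N)`-invariance defects and
`U_p`-eigen defect (eigenvalue the unit `u`) have vanishing moments of order `≤ k`.  Then there is a
`Γ₀(N)`-invariant modular symbol `Φ̂` with values in `D̂_k = lim 𝔻⁰_k/F^N` which is an exact
`U_p`-eigensymbol, `U_p Φ̂ = u Φ̂`, and lifts `Φ₀` modulo `F⁰` (so has the same moments of order `≤ k`).
[cite: Greenberg2007Lifting, Thm. 9] -/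
theorem exists_hatEigensymbol (Φ₀ : P1Q → P1Q → DInt p) (h0 : Φ₀ ∈ modSym ℤ_[p] (DInt p))
    (hΓ0 : ∀ γ : Gamma0 N, ∀ (x y : P1Q) (i : ℕ), i ≤ k →
      moment (((distCoeffInt p k N hpN).slash (gmat γ) Φ₀ - Φ₀) x y).1 i = 0)
    (hU0 : ∀ (x y : P1Q) (i : ℕ), i ≤ k →
      moment (((distCoeffInt p k N hpN).hecke N p Φ₀ - (u : ℤ_[p]) • Φ₀) x y).1 i = 0) :
    ∃ Φ : (hatDist p k N hpN).Symb (Gamma0 N),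
      (hatDist p k N hpN).hecke N p Φ.1 = (u : ℤ_[p]) • Φ.1 ∧
        ∀ x y, (Φ.1 x y).1 0 = Submodule.Quotient.mk (Φ₀ x y) := by
  have hΓ0' : ∀ γ : Gamma0 N, ∀ x y, ((distCoeffInt p k N hpN).slash (gmat γ) Φ₀ - Φ₀) x y ∈ filGInt p k 0 :=
    fun γ x y => liftSeq_start k (fun x y i hi => hΓ0 γ x y i hi) x y
  have hU0' : ∀ x y, ((distCoeffInt p k N hpN).hecke N p Φ₀ - (u : ℤ_[p]) • Φ₀) x y ∈ filGInt p k 0 :=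
    fun x y => liftSeq_start k (fun x y i hi => hU0 x y i hi) x y
  set Φs := redSymb k hpN u Φ₀ h0 hΓ0' hU0' with hΦs
  have hΓS : ∀ γ : SL(2, ℤ), γ ∈ Gamma0 N → (γ : Matrix (Fin 2) (Fin 2) ℤ) ∈ sigma0Set N := fun γ hγ => coe_mem_sigma0Set' γ hγ
  have hβ : ∀ i : HeckeIdx N p, heckeRep p i.1 ∈ sigma0Set N := fun i => heckeRep_mem_sigma0Set Fact.out i
  set Φhat := (distCoeffInt p k N hpN).glueHat (sigma0Set_mulClosed N) (isInvariant_filGInt k N hpN) (filGInt_antitone k) hΓS Φs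
    (fun n n' h x y => redSymb_compat k hpN u Φ₀ h0 hΓ0' hU0' h x y) with hΦhat
  refine ⟨Φhat, ?_, fun x y => rfl⟩
  -- the eigen-property, componentwise
  funext x y
  refine Subtype.ext (funext fun n => ?_)
  have hproj := (distCoeffInt p k N hpN).projSymb_hecke (sigma0Set_mulClosed N) (isInvariant_filGInt k N hpN)
    (filGInt_antitone k) hβ n Φhat.1
  have hcomp : ((distCoeffInt p k N hpN).projHom (sigma0Set_mulClosed N) (isInvariant_filGInt k N hpN) (filGInt_antitone k) n).mapFun
      Φhat.1 = (Φs n).1 := rfl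
  have heig := hecke_redSymb k hpN u Φ₀ h0 hΓ0' hU0' n
  change (((distCoeffInt p k N hpN).projHom (sigma0Set_mulClosed N) (isInvariant_filGInt k N hpN) (filGInt_antitone k) n).mapFun
    ((hatDist p k N hpN).hecke N p Φhat.1)) x y = (u : ℤ_[p]) • ((Φs n).1 x y)
  rw [show (hatDist p k N hpN) = (distCoeffInt p k N hpN).hat (sigma0Set_mulClosed N) (isInvariant_filGInt k N hpN)
    (filGInt_antitone k) from rfl, hproj, hcomp]
  change (filQuot k N hpN n).hecke N p (Φs n).1 x y = _
  rw [heig]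
  rfl

end Main

end Literature.NumberTheory.EllipticCurves

end
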